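import Summits.Ventures.WeilGRH.ZetaWindowAtoms
import Summits.Ventures.WeilGRH.ModulationCostOscillation
import Summits.Ventures.WeilGRH.ModulationCostConstants
import Literature.NumberTheory.LFunctions.WeilMarkovThreePrime
import Literature.NumberTheory.LFunctions.KadiriNumericsBase
import Summits.Ventures.WeilGRH.FrontierRungConstants
import HarnessLib

/-!
# rh-explicit (venture WeilGRH): THE PHASE-BLIND WINDOW CERTIFICATE — one `ζ`-window bounds the spectral mass
  at height `τ` by `log(|τ|/2π) + 2Σ_{n<e^{2a}}Λ(n)n^{-1/2}(1 − log n/2a) + o(1)` WHATEVER THE PRIME PHASES; at the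
  frontier rung `a₀ = 4023/5000` this budget stays below `4a₀` for every `3 ≤ |τ| ≤ 50`

Cell `rh-explicit`, WEIL TRACK (structure seat weil-3, gen11).  RH-free.  Sequel of `ZetaWindowAtoms.lean` (closed
form of the `ζ` window form of the modulated flat window `u_{a,τ} = e^{−iτx}χ_0`, `χ_0 = (2a)^{-1/2}𝟙_{[-a,a]}`, and
`2a·μ{τ} ≤ W_a(u_{a,τ})` for every measure `μ` representing Weil's form on the tests of `[-a,a]`),
`ModulationCostOscillation.lean` (`|∫ρ_κ min(t,2a)cos(τt)| ≤ 2/|τ| + 2/τ²`) and `ModulationCostConstants.lean`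
(`K₀ + ψ(¼) = log π`, `Re ψ(¼+iτ/2) ≤ log(|τ|/2) + 2/τ²`).

* `integral_modulationCost_le_sharp` (every parity, `|τ| ≥ 2`): `∫₀^∞ρ_κ(2(1 − cos τt) + cos(τt)min(t,2a)/a) ≤
  [Re ψ(¼+iτ/2) − Re ψ(¼)] + (2/|τ| + 2/τ²)/a` (the `5/a` of `FlatWindowAtoms.integral_modulationCost_le` replaced);
  **`archBudget_phaseBlind_le`**: `−K₀ + ∫ρ₀(…) ≤ log(|τ|/(2π)) + 2/τ² + (2/|τ| + 2/τ²)/a`;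
* `weilWindowForm_modulated_le_archBlind` / `two_mul_mul_zetaAtom_le_archBlind` (primes kept, archimedean side phase-free);
* **`weilWindowForm_modulated_le_phaseBlind`** (`a > 0`, `|τ| ≥ 2`):
  `W_a(u_{a,τ}) ≤ 4(sinh²(a/2) + sin²(aτ))/(a(¼+τ²)) + log(|τ|/2π) + 2/τ² + (2/|τ| + 2/τ²)/a + 2S(a)`,
  `S(a) = Σ_{log n<2a} Λ(n)n^{-1/2}(1 − log n/2a)` — the PHASE-BLIND BUDGET: no prime phase `cos(τ log n)`, no zero
  ordinate, no value of `ψ` enters; `two_mul_mul_zetaAtom_le_phaseBlind`: the same bounds `2a·μ{τ}` for every Weil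
  measure `μ` of the rung;
* the frontier rung `a₀ = 4023/5000` (the last proved rung below `(log 5)/2`; prime powers `2, 3, 4`):
  `two_mul_flatSum_frontier_le` (**`2S(a₀) ≤ 1.0566`**), `sinh_sq_frontier_le`, `pole_frontier_le` (`P ≤ 5.91/τ²`)
  (`4023/5000 ≤ (log 5)/2` is `EvenWinsBeyondArch.m80_le_log5half` in the tree, or `KadiriNumerics.log_5_bounds` inline),
  `phaseBlindBudget_piece_le`, `phaseBlindBudget_frontier_lt` (budget `< 4a₀` on `3 ≤ |τ| ≤ 50`, five monotone pieces,
  margin `0.019` at `50`);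
* the certificates themselves (`W_{a₀}(u_{a₀,τ}) < 4a₀` and `μ{τ} < 2` for every Weil measure of the frontier rung on
  `3 ≤ |τ| ≤ 50`; the phase-locked extension to `|τ| ≤ 62.5`; `μ{τ} < 3` on `[3,256]`; the RH corollaries) are
  `ZetaLowZerosSimple.lean`.

Under RH `μ = ν_ζ` has atoms `ord_{½+iγ}ζ`, so ONE window of half-length `0.8046`, read WITHOUT A SINGLE PRIME PHASE OR
ZERO ORDINATE, certifies that every zero of `ζ` with `3 ≤ |γ| ≤ 50` — classically the ten lowest zeros `γ₁ = 14.13, …,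
γ₁₀ = 49.77` — is simple (`ZetaLowZerosSimple.lean`, with the phase-locked extension to `|γ| ≤ 62.5` = fourteen zeros,
the `k = 2` range `|γ| ≤ 256` and the explicit law `2a₀μ{τ} ≤ log(|τ|/2π) + 1.0566 + O(1/|τ|)`).  The only arithmetic input is the size of `Λ(n)/√n` for `n = 2, 3, 4`.

No definitions, no named facts; RH-free.  (gen13 note: `two_mul_flatSum_frontier_le` and `sinh_sq_frontier_le` now live
in `FrontierRungConstants.lean`, imported.)
-/

set_option autoImplicit false

noncomputable section

open Complex Filter Set MeasureTheory
open scoped Real Topology ArithmeticFunction.vonMangoldt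

namespace Summit.Ventures.WeilGRH

open Literature.NumberTheory.LFunctions
open Literature.NumberTheory.LFunctions.Yoshida1992 (chi)
open Literature.Analysis.SpecialFunctions (reDigammaQuarter)

variable {a : ℝ}

/-! ## The sharpened archimedean cost of modulation -/

/-- `t ↦ ρ_κ(t)·2(1 − cos τt)` is integrable on `(0, ∞)` (dominated by the parity-`0` case). -/
theorem integrableOn_weilArchDensityPar_modulation (κ : ℕ) (τ : ℝ) :
    IntegrableOn (fun t : ℝ ↦ weilArchDensityPar κ t * (2 * (1 - Real.cos (τ * t)))) (Ioi 0) := by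
  refine (integrableOn_weilArchDensity_modulation τ).mono' ?_ ?_
  · exact ((measurable_weilArchDensityPar κ).mul (by fun_prop : Continuous fun t : ℝ ↦
      2 * (1 - Real.cos (τ * t))).measurable).aestronglyMeasurable
  · refine (ae_restrict_iff' measurableSet_Ioi).2 (Eventually.of_forall fun t (ht : 0 < t) ↦ ?_)
    obtain ⟨h0, hle⟩ := weilArchDensityPar_nonneg_le κ ht
    have hc := (two_mul_one_sub_cos_mem (τ * t)).1
    rw [Real.norm_of_nonneg (mul_nonneg h0 hc)]
    exact mul_le_mul_of_nonneg_right hle hc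

/-- **THE ARCHIMEDEAN COST OF MODULATION, SHARP IN THE HEIGHT**: for `a > 0`, every parity `κ` and every
`|τ| ≥ 2`,

  `∫₀^∞ ρ_κ(t)(2(1 − cos τt) + cos(τt) min(t,2a)/a) dt ≤ [Re ψ(¼+iτ/2) − Re ψ(¼)] + (2/|τ| + 2/τ²)/a`

(`ρ_κ ≤ ρ₀` and `∫ρ₀·2(1 − cos τt) = Re ψ(¼+iτ/2) − Re ψ(¼)`; the oscillatory increment by `…_le_inv`).
Replaces the `5/a` of `FlatWindowAtoms.integral_modulationCost_le`. -/
theorem integral_modulationCost_le_sharp (κ : ℕ) (ha : 0 < a) {τ : ℝ} (hτ : 2 ≤ |τ|) :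
    ∫ t in Ioi (0 : ℝ), weilArchDensityPar κ t *
        (2 * (1 - Real.cos (τ * t)) + Real.cos (τ * t) * (min t (2 * a) / a)) ≤
      (reDigammaQuarter τ - reDigammaQuarter 0) + (2 / |τ| + 2 / τ ^ 2) / a := by
  have hF := integrableOn_weilArchDensityPar_modulation κ τ
  have hG := integrableOn_weilArchDensityPar_mul_min_mul_cos κ ha.le τ
  have hsplit : (fun t : ℝ ↦ weilArchDensityPar κ t *
      (2 * (1 - Real.cos (τ * t)) + Real.cos (τ * t) * (min t (2 * a) / a))) =
      fun t ↦ weilArchDensityPar κ t * (2 * (1 - Real.cos (τ * t))) +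
        1 / a * (weilArchDensityPar κ t * min t (2 * a) * Real.cos (τ * t)) := by
    funext t
    ring
  rw [hsplit, integral_add hF (hG.const_mul _), integral_const_mul]
  have h1 : ∫ t in Ioi (0 : ℝ), weilArchDensityPar κ t * (2 * (1 - Real.cos (τ * t))) ≤
      reDigammaQuarter τ - reDigammaQuarter 0 := by
    rw [← integral_weilArchDensity_modulationCost τ]
    exact setIntegral_mono_on hF (integrableOn_weilArchDensity_modulation τ) measurableSet_Ioi
      fun t (ht : 0 < t) ↦ mul_le_mul_of_nonneg_right (weilArchDensityPar_nonneg_le κ ht).2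
        (two_mul_one_sub_cos_mem _).1
  have h2 : 1 / a * ∫ t in Ioi (0 : ℝ), weilArchDensityPar κ t * min t (2 * a) * Real.cos (τ * t) ≤
      (2 / |τ| + 2 / τ ^ 2) / a := by
    have hb := (le_abs_self _).trans (abs_integral_weilArchDensityPar_mul_min_mul_cos_le_inv κ ha.le hτ)
    calc 1 / a * ∫ t in Ioi (0 : ℝ), weilArchDensityPar κ t * min t (2 * a) * Real.cos (τ * t)
        ≤ 1 / a * (2 / |τ| + 2 / τ ^ 2) := mul_le_mul_of_nonneg_left hb (by positivity)
      _ = (2 / |τ| + 2 / τ ^ 2) / a := by ring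
  linarith

/-- The parity-`0` (`ζ`) form with `weilArchDensity`: for `a > 0`, `|τ| ≥ 2`,
`∫₀^∞ ρ₀(t)(2(1 − cos τt) + cos(τt) min(t,2a)/a) dt ≤ [Re ψ(¼+iτ/2) − Re ψ(¼)] + (2/|τ| + 2/τ²)/a`. -/
theorem integral_modulationCost_zero_le_sharp (ha : 0 < a) {τ : ℝ} (hτ : 2 ≤ |τ|) :
    ∫ t in Ioi (0 : ℝ), weilArchDensity t *
        (2 * (1 - Real.cos (τ * t)) + Real.cos (τ * t) * (min t (2 * a) / a)) ≤
      (reDigammaQuarter τ - reDigammaQuarter 0) + (2 / |τ| + 2 / τ ^ 2) / a := by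
  have h := integral_modulationCost_le_sharp 0 ha hτ
  simp_rw [weilArchDensityPar_zero_apply] at h
  exact h

/-- **THE PHASE-BLIND ARCHIMEDEAN BUDGET OF A MODULATED WINDOW**: for `a > 0` and `|τ| ≥ 2`,

  `−K₀ + ∫₀^∞ ρ₀(t)(2(1 − cos τt) + cos(τt) min(t,2a)/a) dt ≤ log(|τ|/(2π)) + 2/τ² + (2/|τ| + 2/τ²)/a`

(`K₀ = log 4π + γ + 2∫₀^∞(e^{t/2} − 1)dt/(2 sinh t)`; `ModulationCostConstants.archConstants_le_log_height` + the sharp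
cost): the whole archimedean part of the `ζ` window form of `e^{−iτx}χ_0` is `log(|τ|/2π)` up to terms decaying in
the height. -/
theorem archBudget_phaseBlind_le (ha : 0 < a) {τ : ℝ} (hτ : 2 ≤ |τ|) :
    -(Real.log (4 * π) + Real.eulerMascheroniConstant +
          2 * ∫ t in Ioi (0 : ℝ), (Real.exp (t / 2) - 1) / (2 * Real.sinh t)) +
        ∫ t in Ioi (0 : ℝ), weilArchDensity t *
          (2 * (1 - Real.cos (τ * t)) + Real.cos (τ * t) * (min t (2 * a) / a)) ≤
      Real.log (|τ| / (2 * π)) + 2 / τ ^ 2 + (2 / |τ| + 2 / τ ^ 2) / a := by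
  have h1 := integral_modulationCost_zero_le_sharp ha hτ
  have h2 := archConstants_le_log_height hτ
  linarith

/-! ## The window budget at a general window: archimedean side phase-free, primes kept or dropped -/

/-- The pole bound at `θ = −τ`. -/
private theorem pole_le (ha : 0 < a) (τ : ℝ) :
    weilPoleForm (fun x ↦ cexp (I * ((-τ) * x : ℝ)) * chi a 0 x) ≤
      4 * (Real.sinh (a / 2) ^ 2 + Real.sin (τ * a) ^ 2) / (a * (1 / 4 + τ ^ 2)) := by
  have h' := weilPoleForm_modulated_chi_zero_le ha (-τ)
  rwa [neg_mul, Real.sin_neg, neg_sq, neg_sq] at h'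

/-- **THE WINDOW BUDGET WITH THE PRIME PHASES KEPT** (prime side only, no measure): for `a > 0` and `|τ| ≥ 2`,

  `weilWindowForm a (e^{−iτx}χ_0) ≤ 4(sinh²(a/2) + sin²(aτ))/(a(¼+τ²)) + log(|τ|/(2π)) + 2/τ² + (2/|τ| + 2/τ²)/a`
                                  `− 2Σ_{log n<2a} Λ(n)n^{-1/2}(1 − log n/(2a)) cos(τ log n)`

(closed form + pole bound + `archBudget_phaseBlind_le`: only the archimedean side is made phase-free). -/
theorem weilWindowForm_modulated_le_archBlind (ha : 0 < a) {τ : ℝ} (hτ : 2 ≤ |τ|) :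
    weilWindowForm a (fun x ↦ cexp (I * ((-τ) * x : ℝ)) * chi a 0 x) ≤
      4 * (Real.sinh (a / 2) ^ 2 + Real.sin (τ * a) ^ 2) / (a * (1 / 4 + τ ^ 2)) +
        (Real.log (|τ| / (2 * π)) + 2 / τ ^ 2 + (2 / |τ| + 2 / τ ^ 2) / a) -
        2 * (∑ n ∈ weilPrimeIndex a, (Λ n : ℝ) / Real.sqrt n *
          ((1 - Real.log n / (2 * a)) * Real.cos (τ * Real.log n))) := by
  rw [weilWindowForm_modulated_chi_zero ha]
  have hcos : ∀ t : ℝ, Real.cos (-τ * t) = Real.cos (τ * t) := fun t ↦ by rw [neg_mul, Real.cos_neg]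
  simp only [hcos]
  have hP := pole_le ha τ
  have hA := archBudget_phaseBlind_le ha hτ
  linarith

/-- **THE PHASE-BLIND BUDGET OF A WINDOW AT HEIGHT `τ`** (prime side only, no measure, no hypothesis): for
`a > 0` and `|τ| ≥ 2`,

  `weilWindowForm a (e^{−iτx}χ_0) ≤ 4(sinh²(a/2) + sin²(aτ))/(a(¼+τ²)) + log(|τ|/(2π)) + 2/τ² + (2/|τ| + 2/τ²)/a`
                                  `+ 2Σ_{log n<2a} Λ(n)n^{-1/2}(1 − log n/(2a))`

(`…_le_archBlind` + `|cos| ≤ 1`). -/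
theorem weilWindowForm_modulated_le_phaseBlind (ha : 0 < a) {τ : ℝ} (hτ : 2 ≤ |τ|) :
    weilWindowForm a (fun x ↦ cexp (I * ((-τ) * x : ℝ)) * chi a 0 x) ≤
      4 * (Real.sinh (a / 2) ^ 2 + Real.sin (τ * a) ^ 2) / (a * (1 / 4 + τ ^ 2)) +
        (Real.log (|τ| / (2 * π)) + 2 / τ ^ 2 + (2 / |τ| + 2 / τ ^ 2) / a) +
        2 * (∑ n ∈ weilPrimeIndex a, (Λ n : ℝ) / Real.sqrt n * (1 - Real.log n / (2 * a))) := by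
  have h := weilWindowForm_modulated_le_archBlind ha hτ
  have hs := neg_flatSum_le_cos_flatSum ha τ
  linarith

/-- **ONE `ζ`-RUNG BOUNDS THE SPECTRAL MASS AT EVERY HEIGHT — archimedean side phase-free, primes kept.**  Let
`a > 0` and let `μ` represent Weil's form on the tests of `[-a, a]`.  Then for every `|τ| ≥ 2`

  `2a·μ{τ} ≤ 4(sinh²(a/2) + sin²(aτ))/(a(¼+τ²)) + log(|τ|/(2π)) + 2/τ² + (2/|τ| + 2/τ²)/a − 2Σ_{log n<2a} Λ(n)n^{-1/2}(1 − log n/(2a))cos(τ log n)`. -/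
theorem two_mul_mul_zetaAtom_le_archBlind (ha : 0 < a) {μ : Measure ℝ}
    (hμ : ∀ g : ℝ → ℂ, IsWeilTest g → tsupport g ⊆ Icc (-a) a →
      Integrable (fun t : ℝ ↦ ‖weilMellin g (1 / 2 + t * I)‖ ^ 2) μ ∧
        weilQuadratic g = ((∫ t, ‖weilMellin g (1 / 2 + t * I)‖ ^ 2 ∂μ : ℝ) : ℂ)) {τ : ℝ} (hτ : 2 ≤ |τ|) :
    2 * a * μ.real {τ} ≤
      4 * (Real.sinh (a / 2) ^ 2 + Real.sin (τ * a) ^ 2) / (a * (1 / 4 + τ ^ 2)) +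
        (Real.log (|τ| / (2 * π)) + 2 / τ ^ 2 + (2 / |τ| + 2 / τ ^ 2) / a) -
        2 * (∑ n ∈ weilPrimeIndex a, (Λ n : ℝ) / Real.sqrt n *
          ((1 - Real.log n / (2 * a)) * Real.cos (τ * Real.log n))) := by
  have h := two_mul_mul_zetaAtom_le ha hμ τ
  have hP := pole_le ha τ
  have hA := archBudget_phaseBlind_le ha hτ
  linarith

/-- **ONE `ζ`-RUNG BOUNDS THE SPECTRAL MASS AT EVERY HEIGHT, PHASE-BLIND.**  Let `a > 0` and let `μ`
represent Weil's form on the tests of `[-a, a]` (such `μ` exist iff `WeilPositivityOn a`; unconditionally for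
`a ≤ 4023/5000`).  Then for every `|τ| ≥ 2`

  `2a·μ{τ} ≤ 4(sinh²(a/2) + sin²(aτ))/(a(¼+τ²)) + log(|τ|/(2π)) + 2/τ² + (2/|τ| + 2/τ²)/a + 2Σ_{log n<2a} Λ(n)n^{-1/2}(1 − log n/(2a))`. -/
theorem two_mul_mul_zetaAtom_le_phaseBlind (ha : 0 < a) {μ : Measure ℝ}
    (hμ : ∀ g : ℝ → ℂ, IsWeilTest g → tsupport g ⊆ Icc (-a) a →
      Integrable (fun t : ℝ ↦ ‖weilMellin g (1 / 2 + t * I)‖ ^ 2) μ ∧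
        weilQuadratic g = ((∫ t, ‖weilMellin g (1 / 2 + t * I)‖ ^ 2 ∂μ : ℝ) : ℂ)) {τ : ℝ} (hτ : 2 ≤ |τ|) :
    2 * a * μ.real {τ} ≤
      4 * (Real.sinh (a / 2) ^ 2 + Real.sin (τ * a) ^ 2) / (a * (1 / 4 + τ ^ 2)) +
        (Real.log (|τ| / (2 * π)) + 2 / τ ^ 2 + (2 / |τ| + 2 / τ ^ 2) / a) +
        2 * (∑ n ∈ weilPrimeIndex a, (Λ n : ℝ) / Real.sqrt n * (1 - Real.log n / (2 * a))) := by
  have h := two_mul_mul_zetaAtom_le_archBlind ha hμ hτ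
  have hs := neg_flatSum_le_cos_flatSum ha τ
  linarith

/-! ## The frontier rung `a₀ = 4023/5000`: the constants -/

/-- `log 2 < 4023/5000`. -/
theorem log_two_lt_frontier : Real.log 2 < 4023 / 5000 := by
  have := Real.log_two_lt_d9; linarith

/-- **The pole term of the frontier window**: `4(sinh²(a₀/2) + sin²(a₀τ))/(a₀(¼+τ²)) ≤ 5.91/τ²` (`τ ≠ 0`). -/
theorem pole_frontier_le {τ : ℝ} (hτ : τ ≠ 0) :
    4 * (Real.sinh (4023 / 5000 / 2) ^ 2 + Real.sin (τ * (4023 / 5000)) ^ 2) /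
        ((4023 / 5000 : ℝ) * (1 / 4 + τ ^ 2)) ≤ 5.91 / τ ^ 2 := by
  have hs := sinh_sq_frontier_le
  have hsin := Real.sin_sq_le_one (τ * (4023 / 5000))
  have hτ2 : 0 < τ ^ 2 := by positivity
  rw [div_le_div_iff₀ (by positivity) hτ2]
  nlinarith [Real.sin_sq_le_one (τ * (4023 / 5000)), sq_nonneg (Real.sinh (4023 / 5000 / 2)),
    sq_nonneg (Real.sin (τ * (4023 / 5000)))]

/-- One monotone piece of the range argument: on `T₁ ≤ u ≤ T₂` (`T₁ > 0`) the phase-blind budget of the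
frontier window is at most its value with `log` at `T₂` and the decaying terms at `T₁`. -/
theorem phaseBlindBudget_piece_le {u T₁ T₂ : ℝ} (hT₁ : 0 < T₁) (h1 : T₁ ≤ u) (h2 : u ≤ T₂) :
    Real.log (u / (2 * π)) + 2 / u ^ 2 + (2 / u + 2 / u ^ 2) / (4023 / 5000) + 5.91 / u ^ 2 ≤
      (Real.log T₂ - Real.log 2 - Real.log π) + 2 / T₁ ^ 2 + (2 / T₁ + 2 / T₁ ^ 2) / (4023 / 5000) +
        5.91 / T₁ ^ 2 := by
  have hu : 0 < u := lt_of_lt_of_le hT₁ h1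
  have hT₂ : 0 < T₂ := lt_of_lt_of_le hu h2
  have hlog : Real.log (u / (2 * π)) ≤ Real.log T₂ - Real.log 2 - Real.log π := by
    rw [Real.log_div hu.ne' (by positivity), Real.log_mul two_ne_zero Real.pi_pos.ne']
    linarith [Real.log_le_log hu h2]
  have hsq : T₁ ^ 2 ≤ u ^ 2 := pow_le_pow_left₀ hT₁.le h1 2
  have hT₁2 : 0 < T₁ ^ 2 := by positivity
  have ha : 2 / u ^ 2 ≤ 2 / T₁ ^ 2 := div_le_div_of_nonneg_left (by norm_num) hT₁2 hsq
  have hb : 2 / u ≤ 2 / T₁ := div_le_div_of_nonneg_left (by norm_num) hT₁ h1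
  have hc : (5.91 : ℝ) / u ^ 2 ≤ 5.91 / T₁ ^ 2 := div_le_div_of_nonneg_left (by norm_num) hT₁2 hsq
  have hd : (2 / u + 2 / u ^ 2) / (4023 / 5000 : ℝ) ≤ (2 / T₁ + 2 / T₁ ^ 2) / (4023 / 5000) :=
    div_le_div_of_nonneg_right (add_le_add hb ha) (by norm_num)
  linarith

/-- **THE PHASE-BLIND BUDGET OF THE FRONTIER WINDOW IS BELOW `4a₀` ON `3 ≤ |τ| ≤ 50`**:
`log(u/2π) + 2/u² + (2/u + 2/u²)/a₀ + 5.91/u² + 1.0566 < 4a₀ = 3.2184` for `3 ≤ u ≤ 50`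
(five monotone pieces `[3,6]`, `[6,12]`, `[12,24]`, `[24,40]`, `[40,50]`; margin `0.019` at the top). -/
theorem phaseBlindBudget_frontier_lt {u : ℝ} (h3 : 3 ≤ u) (h50 : u ≤ 50) :
    Real.log (u / (2 * π)) + 2 / u ^ 2 + (2 / u + 2 / u ^ 2) / (4023 / 5000) + 5.91 / u ^ 2 + 1.0566 <
      4 * (4023 / 5000 : ℝ) := by
  have hl2 := Real.log_two_gt_d9
  have hl2' := Real.log_two_lt_d9
  obtain ⟨-, hl3⟩ := KadiriNumerics.log_3_bounds
  obtain ⟨-, hl5⟩ := KadiriNumerics.log_5_bounds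
  obtain ⟨hlpi, -⟩ := KadiriNumerics.log_pi_bounds
  have hlog6 : Real.log 6 = Real.log 2 + Real.log 3 := by
    rw [show (6 : ℝ) = 2 * 3 by norm_num, Real.log_mul (by norm_num) (by norm_num)]
  have hlog12 : Real.log 12 = 2 * Real.log 2 + Real.log 3 := by
    rw [show (12 : ℝ) = 2 ^ 2 * 3 by norm_num, Real.log_mul (by norm_num) (by norm_num), Real.log_pow]
    norm_num
  have hlog24 : Real.log 24 = 3 * Real.log 2 + Real.log 3 := by
    rw [show (24 : ℝ) = 2 ^ 3 * 3 by norm_num, Real.log_mul (by norm_num) (by norm_num), Real.log_pow]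
    norm_num
  have hlog40 : Real.log 40 = 3 * Real.log 2 + Real.log 5 := by
    rw [show (40 : ℝ) = 2 ^ 3 * 5 by norm_num, Real.log_mul (by norm_num) (by norm_num), Real.log_pow]
    norm_num
  have hlog50 : Real.log 50 = Real.log 2 + 2 * Real.log 5 := by
    rw [show (50 : ℝ) = 2 * 5 ^ 2 by norm_num, Real.log_mul (by norm_num) (by norm_num), Real.log_pow]
    norm_num
  rcases le_or_gt u 6 with h6 | h6
  · have hp := phaseBlindBudget_piece_le (by norm_num : (0 : ℝ) < 3) h3 h6
    rw [hlog6] at hp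
    norm_num at hp ⊢
    linarith
  rcases le_or_gt u 12 with h12 | h12
  · have hp := phaseBlindBudget_piece_le (by norm_num : (0 : ℝ) < 6) h6.le h12
    rw [hlog12] at hp
    norm_num at hp ⊢
    linarith
  rcases le_or_gt u 24 with h24 | h24
  · have hp := phaseBlindBudget_piece_le (by norm_num : (0 : ℝ) < 12) h12.le h24
    rw [hlog24] at hp
    norm_num at hp ⊢
    linarith
  rcases le_or_gt u 40 with h40 | h40
  · have hp := phaseBlindBudget_piece_le (by norm_num : (0 : ℝ) < 24) h24.le h40
    rw [hlog40] at hp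
    norm_num at hp ⊢
    linarith
  · have hp := phaseBlindBudget_piece_le (by norm_num : (0 : ℝ) < 40) h40.le h50
    rw [hlog50] at hp
    norm_num at hp ⊢
    linarith

end Summit.Ventures.WeilGRH

end
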